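import Literature.Computability.Complexity.MultilinearExtension
import Literature.Computability.Cryptography.QuantumQuery
import HarnessLib

/-!
# The polynomial method: amplitudes and acceptance probabilities are low-degree polynomials

Beals–Buhrman–Cleve–Mosca–de Wolf, *Quantum lower bounds by polynomials*, J. ACM 48 (2001),
§4.1, for the tree's query model `Literature.Computability.Cryptography.QQueryAlg`
(`QuantumQuery.lean`: basis `Fin N × Bool × W`, oracle `O_x |i,b,z⟩ = |i, b ⊕ x_i, z⟩`,
final state `U_T O_x ⋯ O_x U_0 |start⟩`, Born acceptance probability `acceptProb`).

* **Lemma 4.1** (`hasDegreeLE_finalState`): "Let `N` be a quantum network that makes `T`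
  queries to a black-box `X`. Then there exist complex-valued `N`-variate multilinear
  polynomials `p_0, …, p_{2^m-1}`, each of degree at most `T`, such that the final state of the
  network is the superposition `∑_k p_k(X) |k⟩` for any black-box `X`."
* **Lemma 4.2** (`exists_acceptPolynomial`): "… there exists a real-valued multilinear
  polynomial `P(X)` of degree at most `2T`, which equals the probability that observing the
  final state of the network with black-box `X` yields a state from `B`."
* the consequence used for Theorems 4.8/4.13 (`exists_polynomial_of_computesWithError`): an
  `ε`-error algorithm for `f` on a promise set `D` gives `P` of degree `≤ 2T` with
  `0 ≤ P ≤ 1` on `{0,1}^N`, `P ≥ 1 - ε` on `f⁻¹(1) ∩ D` and `P ≤ ε` on `f⁻¹(0) ∩ D`; and, on the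
  way, unitarity of the evolution (`sum_norm_sq_finalState`) and `acceptProb ≤ 1`
  (`QQueryAlg.acceptProb_le_one'`), discharging the tree fact `QQueryAlg.acceptProb_le_one`
  (`QQueryAlg.acceptProb_le_one_holds`).

**The printed proof** (p. 7): the amplitudes after `U_0` are constants; "a query maps basis
state `|i,b,z⟩` to `|i, b ⊕ x_i, z⟩`. Hence if the amplitude of `|i,0,z⟩` is `α` and the
amplitude of `|i,1,z⟩` is `β`, then the amplitude of `|i,0,z⟩` after the query becomes
`(1 - x_i)α + x_iβ` and the amplitude of `|i,1,z⟩` becomes `x_iα + (1 - x_i)β`, which are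
polynomials of degree `1`" (`HasDegreeLE.oracle`); "the amplitudes after applying `U_1` are
just linear combinations of the amplitudes before" (`HasDegreeLE.mulVec`); induction over the
`T` rounds (`foldl_invariant` applied to the `Fin.foldl` defining `finalState`, after
commuting the fold with the dependence on `x`, `foldl_pi`). Lemma 4.2: `|p_k|² = (Re p_k)² +
(Im p_k)²` summed over the accepting basis states.

Design. "Polynomial of degree `≤ d`" is the predicate `HasDegreeLE d a` on amplitude
functions `a : (Fin N → Bool) → ℂ`: the real and imaginary parts are values of real
`MvPolynomial (Fin N) ℝ` of `totalDegree ≤ d` at the `0/1`-vector `Multilinear.boolPt (R := ℝ) x`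
(the
tree's evaluation-point convention, `MultilinearExtension.lean`). Only values on the Boolean
cube matter downstream, so the printed multilinearisation ("replace `x_i^k` by `x_i`") is NOT
asserted or performed here — the statements give `totalDegree ≤ T` / `≤ 2T`, formally weaker
than "multilinear of degree `≤ T`"; multilinearise via `Multilinear.ofCube` /
`Multilinear.eval_boolPt_ofCube` when a multilinear representative is needed. Mathlib supplies
`MvPolynomial.totalDegree_*`, `Matrix.permMatrix_mulVec`, `Matrix.unitaryGroup`. The generic
`ℓ²` lemmas `sum_norm_sq_eq_re_dotProduct` / `sum_norm_sq_mulVec_of_mem_unitaryGroup` duplicate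
special cases elsewhere in the tree (`QuantumCircuitProofs.normSq_mulVec_of_mem_unitaryGroup`
for `QReg`, and a copy in `Barriers/AtomisticToContinuum`); they are a `HarnessLib` candidate
for a librarian to consolidate.

## References

* R. Beals, H. Buhrman, R. Cleve, M. Mosca, R. de Wolf, *Quantum lower bounds by polynomials*,
  J. ACM 48 (2001) 778–797, Lemma 4.1, Lemma 4.2, §4.2 (arXiv:quant-ph/9802049, pp. 7–8)
  [BealsEtAl2001].
-/

namespace Literature.Computability.QuantumComplexity

open Matrix Finset Literature.Computability.Cryptography Literature.Computability.Complexity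

/-! ### A `Fin.foldl` invariant principle -/

/-- Invariant principle for `Fin.foldl`: a predicate `P j` of the number of steps that holds
initially and is preserved by each step holds after `n` steps. [folklore] -/
theorem foldl_invariant {α : Type*} (n : ℕ) (f : α → Fin n → α) (init : α) (P : ℕ → α → Prop)
    (h0 : P 0 init) (hstep : ∀ (j : Fin n) (a : α), P j a → P (j + 1) (f a j)) :
    P n (Fin.foldl n f init) := by
  induction n generalizing P init with
  | zero => simpa using h0
  | succ n ih =>
    rw [Fin.foldl_succ]
    exact ih (fun a i => f a i.succ) (f init 0) (fun j a => P (j + 1) a) (hstep 0 init h0)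
      (fun j a hj => hstep j.succ a hj)

/-- A fold of functions is the function of the folds: `b ↦ Fin.foldl n (g b) (init b)` is the fold
of the families. [folklore] -/
theorem foldl_pi {α β : Type*} (n : ℕ) (g : β → α → Fin n → α) (init : β → α) :
    (fun b => Fin.foldl n (g b) (init b)) = Fin.foldl n (fun Ψ j => fun b => g b (Ψ b) j) init := by
  induction n generalizing init with
  | zero => funext b; simp
  | succ n ih =>
    funext b
    rw [Fin.foldl_succ, Fin.foldl_succ]
    exact congrFun (ih (fun b a i => g b a i.succ) (fun b => g b (init b) 0)) b

/-! ### Permutation matrices and the oracle act by substitution -/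

/-- The oracle acts by substitution: `(O_x ψ)(i,b,z) = ψ(i, b ⊕ x_i, z)` ("a query maps basis state
`|i,b,z⟩` to `|i,b ⊕ x_i,z⟩`"; Mathlib `Matrix.permMatrix_mulVec`). [cite: BealsEtAl2001, Lemma 4.1
(proof)] -/
theorem queryOracle_mulVec_apply {N : ℕ} {W : Type*} [Fintype W] [DecidableEq W]
    (x : Fin N → Bool) (ψ : Fin N × Bool × W → ℂ) (s : Fin N × Bool × W) :
    (queryOracle x *ᵥ ψ) s = ψ (s.1, (s.2.1 ^^ x s.1), s.2.2) := by
  rw [queryOracle, Matrix.permMatrix_mulVec, Function.comp_apply, queryPerm_apply, queryMap_apply]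

/-! ### Unitaries preserve the `ℓ²` norm; acceptance probabilities are at most `1` -/

/-- `∑_i ‖v_i‖² = Re ⟨v, v⟩`. [folklore] -/
theorem sum_norm_sq_eq_re_dotProduct {n : Type*} [Fintype n] (v : n → ℂ) :
    ∑ i, ‖v i‖ ^ 2 = (star v ⬝ᵥ v).re := by
  simp only [dotProduct, Pi.star_apply, Complex.re_sum]
  refine Finset.sum_congr rfl fun i _ => ?_
  rw [Complex.star_def, Complex.conj_mul']
  norm_cast

/-- Unitary matrices preserve `∑_i ‖v_i‖²`. [folklore] -/
theorem sum_norm_sq_mulVec_of_mem_unitaryGroup {n : Type*} [Fintype n] [DecidableEq n]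
    {U : Matrix n n ℂ} (hU : U ∈ Matrix.unitaryGroup n ℂ) (v : n → ℂ) :
    ∑ i, ‖(U *ᵥ v) i‖ ^ 2 = ∑ i, ‖v i‖ ^ 2 := by
  have h1 : Uᴴ * U = 1 := by
    simpa [Matrix.star_eq_conjTranspose] using Matrix.mem_unitaryGroup_iff'.mp hU
  rw [sum_norm_sq_eq_re_dotProduct, sum_norm_sq_eq_re_dotProduct, star_mulVec,
    dotProduct_mulVec, vecMul_vecMul, h1, vecMul_one]

/-- The final state of a query algorithm is a unit vector (all `U_j` and `O_x` are unitary,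
`|start⟩` is a basis vector). [cite: BealsEtAl2001, §2] -/
theorem sum_norm_sq_finalState {N : ℕ} (A : QQueryAlg N) (x : Fin N → Bool) :
    ∑ s, ‖A.finalState x s‖ ^ 2 = 1 := by
  unfold QQueryAlg.finalState
  refine foldl_invariant (P := fun (_ : ℕ) (ψ : Fin N × Bool × A.W → ℂ) =>
    ∑ s, ‖ψ s‖ ^ 2 = (1 : ℝ)) A.queries
    (fun ψ j => (A.unitaries j.succ).1 *ᵥ (queryOracle x *ᵥ ψ))
    ((A.unitaries 0).1 *ᵥ Pi.single A.start 1) ?_ ?_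
  · rw [sum_norm_sq_mulVec_of_mem_unitaryGroup (A.unitaries 0).2]
    rw [Finset.sum_eq_single A.start]
    · simp
    · intro s _ hs; simp [hs]
    · simp
  · intro j ψ hψ
    rw [sum_norm_sq_mulVec_of_mem_unitaryGroup (A.unitaries j.succ).2,
      sum_norm_sq_mulVec_of_mem_unitaryGroup (queryOracle_mem_unitaryGroup x), hψ]

/-- Acceptance probabilities are at most `1` (the content of the tree fact
`QQueryAlg.acceptProb_le_one`: all `U_j` and `O_x` are unitary and `|start⟩` is a unit vector).
[cite: BealsEtAl2001, §2] -/
theorem _root_.Literature.Computability.Cryptography.QQueryAlg.acceptProb_le_one' {N : ℕ}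
    (A : QQueryAlg N) (x : Fin N → Bool) : A.acceptProb x ≤ 1 := by
  classical
  unfold QQueryAlg.acceptProb
  rw [← sum_norm_sq_finalState A x]
  exact Finset.sum_le_univ_sum_of_nonneg fun s => by positivity

/-- **Discharge of the tree fact `QQueryAlg.acceptProb_le_one`** (`QuantumQuery.lean`).
[cite: BealsEtAl2001, §2] -/
theorem _root_.Literature.Computability.Cryptography.QQueryAlg.acceptProb_le_one_holds {N : ℕ} :
    QQueryAlg.acceptProb_le_one (N := N) :=
  fun A x => A.acceptProb_le_one' x

/-! ### Amplitudes are polynomials of degree at most the number of queries -/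

/-- `a` is (on Boolean inputs) a complex polynomial of degree `≤ d`: its real and imaginary
parts are values of real `N`-variate polynomials of total degree `≤ d` (the form in which
Lemma 4.1's "complex-valued `N`-variate polynomials of degree at most `T`" is used in Lemma 4.2:
"split `p_k` into its real and imaginary parts"). [cite: BealsEtAl2001, Lemma 4.1] -/
def HasDegreeLE {N : ℕ} (d : ℕ) (a : (Fin N → Bool) → ℂ) : Prop :=
  ∃ P Q : MvPolynomial (Fin N) ℝ, P.totalDegree ≤ d ∧ Q.totalDegree ≤ d ∧
    ∀ x, a x = (MvPolynomial.eval (Multilinear.boolPt (R := ℝ) x) P : ℂ) +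
      (MvPolynomial.eval (Multilinear.boolPt (R := ℝ) x) Q : ℂ) * Complex.I

namespace HasDegreeLE

variable {N : ℕ}

/-- Constants have degree `≤ d`. [folklore] -/
theorem const (d : ℕ) (c : ℂ) : HasDegreeLE (N := N) d fun _ => c := by
  refine ⟨MvPolynomial.C c.re, MvPolynomial.C c.im, by simp, by simp, fun x => ?_⟩
  simp [Complex.re_add_im]

/-- `0` has degree `≤ d`. [folklore] -/
theorem zero (d : ℕ) : HasDegreeLE (N := N) d fun _ => 0 := const d 0

/-- Sums preserve the degree bound. [folklore] -/
theorem add {d : ℕ} {a b : (Fin N → Bool) → ℂ} (ha : HasDegreeLE d a) (hb : HasDegreeLE d b) :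
    HasDegreeLE d fun x => a x + b x := by
  obtain ⟨P, Q, hP, hQ, h⟩ := ha
  obtain ⟨P', Q', hP', hQ', h'⟩ := hb
  refine ⟨P + P', Q + Q', (MvPolynomial.totalDegree_add _ _).trans (max_le hP hP'),
    (MvPolynomial.totalDegree_add _ _).trans (max_le hQ hQ'), fun x => ?_⟩
  beta_reduce
  rw [h, h']
  push_cast [map_add]
  ring

/-- Complex scalar multiples preserve the degree bound (`(a+bi)(P+iQ) = (aP-bQ) + i(aQ+bP)`).
[folklore] -/
theorem const_mul {d : ℕ} (c : ℂ) {a : (Fin N → Bool) → ℂ} (ha : HasDegreeLE d a) :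
    HasDegreeLE d fun x => c * a x := by
  obtain ⟨P, Q, hP, hQ, h⟩ := ha
  refine ⟨MvPolynomial.C c.re * P - MvPolynomial.C c.im * Q,
    MvPolynomial.C c.re * Q + MvPolynomial.C c.im * P, ?_, ?_, fun x => ?_⟩
  · exact (MvPolynomial.totalDegree_sub _ _).trans (max_le
      ((MvPolynomial.totalDegree_mul _ _).trans (by simpa using hP))
      ((MvPolynomial.totalDegree_mul _ _).trans (by simpa using hQ)))
  · exact (MvPolynomial.totalDegree_add _ _).trans (max_le
      ((MvPolynomial.totalDegree_mul _ _).trans (by simpa using hQ))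
      ((MvPolynomial.totalDegree_mul _ _).trans (by simpa using hP)))
  · beta_reduce
    rw [h]
    conv_lhs => rw [← Complex.re_add_im c]
    push_cast [map_add, map_sub, map_mul, MvPolynomial.eval_C]
    ring_nf
    rw [Complex.I_sq]
    ring

/-- Finite sums preserve the degree bound. [folklore] -/
theorem sum {d : ℕ} {ι : Type*} (s : Finset ι) {a : ι → (Fin N → Bool) → ℂ}
    (ha : ∀ i ∈ s, HasDegreeLE d (a i)) : HasDegreeLE d fun x => ∑ i ∈ s, a i x := by
  classical
  induction s using Finset.induction_on with
  | empty => simpa using zero d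
  | insert i s hi ih =>
    simp only [Finset.sum_insert hi]
    exact add (ha i (Finset.mem_insert_self i s))
      (ih fun j hj => ha j (Finset.mem_insert_of_mem hj))

/-- Multiplication by a constant matrix preserves the degree bound ("the amplitudes after applying
`U_1` are just linear combinations of the amplitudes before applying `U_1`"). [cite: BealsEtAl2001,
Lemma 4.1] -/
theorem mulVec {d : ℕ} {n : Type*} [Fintype n] (M : Matrix n n ℂ)
    {ψ : (Fin N → Bool) → n → ℂ} (hψ : ∀ s, HasDegreeLE d fun x => ψ x s) (s : n) :
    HasDegreeLE d fun x => (M *ᵥ ψ x) s := by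
  simp only [Matrix.mulVec, dotProduct]
  exact sum _ fun t _ => const_mul (M s t) (hψ t)

/-- One oracle query raises the degree bound by one:
`(O_x ψ)(i,b,z) = (1 - x_i) ψ(i,b,z) + x_i ψ(i,¬b,z)` ("if the amplitudes before a query are
polynomials of degree `≤ j`, then the amplitudes after the query will be polynomials of degree
`≤ j+1`"). [cite: BealsEtAl2001, Lemma 4.1] -/
theorem oracle {d : ℕ} {W : Type*} [Fintype W] [DecidableEq W]
    {ψ : (Fin N → Bool) → Fin N × Bool × W → ℂ} (hψ : ∀ s, HasDegreeLE d fun x => ψ x s)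
    (s : Fin N × Bool × W) : HasDegreeLE (d + 1) fun x => (queryOracle x *ᵥ ψ x) s := by
  obtain ⟨i, b, z⟩ := s
  obtain ⟨P, Q, hP, hQ, h⟩ := hψ (i, b, z)
  obtain ⟨P', Q', hP', hQ', h'⟩ := hψ (i, !b, z)
  beta_reduce at h h'
  have hX : (MvPolynomial.X i : MvPolynomial (Fin N) ℝ).totalDegree ≤ 1 := by
    rw [MvPolynomial.totalDegree_X]
  have h1X : (1 - MvPolynomial.X i : MvPolynomial (Fin N) ℝ).totalDegree ≤ 1 :=
    (MvPolynomial.totalDegree_sub _ _).trans (max_le (by simp) hX)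
  refine ⟨(1 - MvPolynomial.X i) * P + MvPolynomial.X i * P',
    (1 - MvPolynomial.X i) * Q + MvPolynomial.X i * Q', ?_, ?_, fun x => ?_⟩
  · refine (MvPolynomial.totalDegree_add _ _).trans (max_le ?_ ?_) <;>
      refine (MvPolynomial.totalDegree_mul _ _).trans ?_ <;> omega
  · refine (MvPolynomial.totalDegree_add _ _).trans (max_le ?_ ?_) <;>
      refine (MvPolynomial.totalDegree_mul _ _).trans ?_ <;> omega
  · simp only [queryOracle_mulVec_apply]
    cases hxi : x i
    · simp only [Bool.xor_false]
      rw [h]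
      simp [map_add, map_sub, map_mul, MvPolynomial.eval_X, hxi]
    · simp only [Bool.xor_true]
      rw [h']
      simp [map_add, map_sub, map_mul, MvPolynomial.eval_X, hxi]

end HasDegreeLE

/-- **Beals et al. Lemma 4.1**: the amplitudes of the final state of a `T`-query network are
(on Boolean inputs) polynomials of degree `≤ T` in the input bits. [cite: BealsEtAl2001, Lemma 4.1]
-/
theorem hasDegreeLE_finalState {N : ℕ} (A : QQueryAlg N) (s : Fin N × Bool × A.W) :
    HasDegreeLE A.queries fun x => A.finalState x s := by
  have hfold := foldl_pi A.queries
    (fun (x : Fin N → Bool) (ψ : Fin N × Bool × A.W → ℂ) (j : Fin A.queries) =>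
      (A.unitaries j.succ).1 *ᵥ (queryOracle x *ᵥ ψ))
    (fun _ => (A.unitaries 0).1 *ᵥ Pi.single A.start 1)
  have key : ∀ s, HasDegreeLE (0 + A.queries) fun x =>
      (fun b => Fin.foldl A.queries (fun ψ j => (A.unitaries j.succ).1 *ᵥ (queryOracle b *ᵥ ψ))
        ((A.unitaries 0).1 *ᵥ Pi.single A.start 1)) x s := by
    rw [hfold]
    refine foldl_invariant
      (P := fun j (Ψ : (Fin N → Bool) → Fin N × Bool × A.W → ℂ) =>
        ∀ s, HasDegreeLE (0 + j) fun x => Ψ x s)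
      A.queries (fun Ψ j => fun b => (A.unitaries j.succ).1 *ᵥ (queryOracle b *ᵥ Ψ b))
      (fun _ => (A.unitaries 0).1 *ᵥ Pi.single A.start 1) ?_ ?_
    · intro s
      exact HasDegreeLE.mulVec (ψ := fun _ => Pi.single A.start 1) _
        (fun t => HasDegreeLE.const 0 _) s
    · intro j Ψ hΨ s
      rw [← add_assoc]
      exact HasDegreeLE.mulVec _ (fun t => HasDegreeLE.oracle hΨ t) s
  simpa [QQueryAlg.finalState] using key s

/-- **Beals et al. Lemma 4.2**: the acceptance probability of a `T`-query network is (on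
Boolean inputs) a real `N`-variate polynomial of total degree `≤ 2T`
(`P = ∑_{k ∈ accept} (Re p_k)² + (Im p_k)²`). [cite: BealsEtAl2001, Lemma 4.2] -/
theorem exists_acceptPolynomial {N : ℕ} (A : QQueryAlg N) :
    ∃ P : MvPolynomial (Fin N) ℝ, P.totalDegree ≤ 2 * A.queries ∧
      ∀ x, A.acceptProb x = MvPolynomial.eval (Multilinear.boolPt (R := ℝ) x) P := by
  classical
  choose P Q hP hQ h using fun s => hasDegreeLE_finalState A s
  beta_reduce at h
  refine ⟨∑ s with s ∈ A.accept, (P s ^ 2 + Q s ^ 2), ?_, fun x => ?_⟩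
  · refine (MvPolynomial.totalDegree_finsetSum _ _).trans (Finset.sup_le fun s _ => ?_)
    refine (MvPolynomial.totalDegree_add _ _).trans (max_le ?_ ?_)
    · exact (MvPolynomial.totalDegree_pow _ _).trans (by have := hP s; omega)
    · exact (MvPolynomial.totalDegree_pow _ _).trans (by have := hQ s; omega)
  · unfold QQueryAlg.acceptProb
    rw [map_sum]
    refine Finset.sum_congr rfl fun s _ => ?_
    rw [h s x, Complex.sq_norm, Complex.normSq_apply]
    simp
    ring

/-- The polynomial method for a Boolean function: a `T`-query algorithm computing `f` with
error `ε` on the promise set `D` yields a real polynomial `P` of degree `≤ 2T` (multilinearity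
not asserted, see the module docstring) with `0 ≤ P(x) ≤ 1` on the whole Boolean cube
("because `P` represents a probability"), `P(x) ≥ 1 - ε` where `f(x) = 1` and `P(x) ≤ ε` where
`f(x) = 0`, for `x ∈ D` ("if `f(X)=0` then we should have `P(X) ≤ 1/3`, and if `f(X) = 1`
then `P(X) ≥ 2/3`", §4.2 and proof of Thm 4.13; partial functions: end of §4.3).
[cite: BealsEtAl2001, §4.2 (Thm 4.8) and Thm 4.13 (proof)] -/
theorem exists_polynomial_of_computesWithError {N : ℕ} {ε : ℝ} {D : Set (Fin N → Bool)}
    {f : (Fin N → Bool) → Bool} {A : QQueryAlg N} (hA : A.ComputesWithError ε D f) :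
    ∃ P : MvPolynomial (Fin N) ℝ, P.totalDegree ≤ 2 * A.queries ∧
      (∀ x, 0 ≤ MvPolynomial.eval (Multilinear.boolPt (R := ℝ) x) P ∧
        MvPolynomial.eval (Multilinear.boolPt (R := ℝ) x) P ≤ 1) ∧
      (∀ x ∈ D, f x = true → 1 - ε ≤ MvPolynomial.eval (Multilinear.boolPt (R := ℝ) x) P) ∧
      (∀ x ∈ D, f x = false → MvPolynomial.eval (Multilinear.boolPt (R := ℝ) x) P ≤ ε) := by
  obtain ⟨P, hP, h⟩ := exists_acceptPolynomial A
  refine ⟨P, hP, fun x => ?_, fun x hx hfx => ?_, fun x hx hfx => ?_⟩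
  · rw [← h x]; exact ⟨A.acceptProb_nonneg x, A.acceptProb_le_one' x⟩
  · rw [← h x]; exact (hA x hx).1 hfx
  · rw [← h x]; exact (hA x hx).2 hfx

end Literature.Computability.QuantumComplexity
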